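import Literature.Computability.AlgebraicComplexity.BI17TernaryFormJordanStabilizer
import HarnessLib

/-!
# Ternary quartics fixed by the regular unipotent substitution

Theorem-only companion (cell `val-lit`, row BI2017-A; no definitions, no named facts) of
`BI17TernaryFormJordanStabilizer.lean`: the space of quartic forms `f ∈ Sym⁴ ℂ³` fixed by the
regular unipotent substitution `u` (`x₀ ↦ x₀`, `x₁ ↦ x₀ + x₁`, `x₂ ↦ x₁ + x₂`; matrix
`(1 1 0; 0 1 1; 0 0 1)` in the tree's column convention `x_i ↦ ∑_j u_{ji} x_j`) is the
`3`-dimensional space spanned by `x₀⁴`, `x₀² q`, `q²` with the invariant quadric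
`q = x₁² - 2 x₀ x₂ - x₀ x₁` (`exists_eq_of_unipotent_fixed_quartic`). Hence a form whose
stabilizer contains a regular unipotent element (up to a scalar with `λ⁴ = 1`) lies in a
`3 + 9 = 12 < 15 = dim Sym⁴ ℂ³` parameter family — the regular-unipotent case of the dimension
count behind "a generic ternary quartic has trivial stabilizer" (Bürgisser–Ikenmeyer 2017
Thm. 2.3 at `(D, m) = (4, 3)` as corrected, erratum A21; Poonen 2005 Thm. 3 at `(n, d) = (1, 4)`).

Proof: `u · f = f` is a system of linear equations in the `15` coefficients of `f`; twelve
evaluations `f(p₀, p₀ + p₁, p₁ + p₂) = f(p₀, p₁, p₂)` at small integer points `p` already have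
rank `12`, and the kernel checks a rational certificate (multipliers found offline by exact
Gaussian elimination) expressing every coefficient in terms of those of `x₀⁴`, `x₀³ x₁`, `x₁⁴`
(`linear_combination`). Also: the expansion of a ternary form of degree `d` along the monomials
`x₀^a x₁^b x₂^{d-a-b}` (`eq_sum_monomial_fin_three`) and evaluation lemmas.

Honest framing: classical invariant-theory bookkeeping; nothing here bears on VP versus VNP.

## References

* [BurgisserIkenmeyer2017] P. Bürgisser, C. Ikenmeyer, *Fundamental invariants of orbit closures*,
  J. Algebra 477 (2017) 390–434, §2.1 Thm. 2.3 and Appendix Prop. 7.5.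
* [Poonen2005] B. Poonen, *Varieties without extra automorphisms III: hypersurfaces*, Finite
  Fields Appl. 11 (2005), Thm. 3.
-/

noncomputable section

open MvPolynomial
open scoped BigOperators

namespace Literature.Computability.AlgebraicComplexity

/-! ### §1 Ternary forms along the monomials `x₀^a x₁^b x₂^c` -/

section Expansion

/-- **Expansion of a ternary form of degree `d`** along the monomials `x₀^a x₁^b x₂^{d-a-b}`,
`a + b ≤ d`. (Step of the dimension count for BI 2017 Thm. 2.3 / App. Prop. 7.5, ternary forms.)
[cite: BurgisserIkenmeyer2017, §7 (Appendix) Prop. 7.5] -/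
theorem eq_sum_monomial_fin_three {d : ℕ} {f : MvPolynomial (Fin 3) ℂ} (hf : f.IsHomogeneous d) :
    f = ∑ a ∈ Finset.range (d + 1), ∑ b ∈ Finset.range (d + 1 - a),
      monomial (Finsupp.single 0 a + Finsupp.single 1 b + Finsupp.single 2 (d - a - b))
        (coeff (Finsupp.single 0 a + Finsupp.single 1 b + Finsupp.single 2 (d - a - b)) f) := by
  classical
  set ι : (Σ _ : ℕ, ℕ) → (Fin 3 →₀ ℕ) := fun x =>
    Finsupp.single 0 x.1 + Finsupp.single 1 x.2 + Finsupp.single 2 (d - x.1 - x.2) with hι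
  set S : Finset (Σ _ : ℕ, ℕ) := (Finset.range (d + 1)).sigma fun a => Finset.range (d + 1 - a)
    with hS
  have hι0 : ∀ x, ι x 0 = x.1 := fun x => by simp [hι]
  have hι1 : ∀ x, ι x 1 = x.2 := fun x => by simp [hι]
  rw [Finset.sum_sigma']
  change f = ∑ x ∈ S, monomial (ι x) (coeff (ι x) f)
  have hinj : Set.InjOn ι ↑S := by
    intro x _ y _ hxy
    have h0 := congrArg (fun e : Fin 3 →₀ ℕ => e 0) hxy
    have h1 := congrArg (fun e : Fin 3 →₀ ℕ => e 1) hxy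
    simp only [hι0, hι1] at h0 h1
    exact Sigma.ext h0 (heq_of_eq h1)
  rw [← Finset.sum_image (f := fun e => monomial e (coeff e f)) hinj]
  have hsub : f.support ⊆ S.image ι := by
    intro e he
    have hdeg : Finsupp.weight (1 : Fin 3 → ℕ) e = d := hf (mem_support_iff.mp he)
    rw [Finsupp.weight_apply, Finsupp.sum_fintype _ _ (fun _ => by simp)] at hdeg
    simp only [Pi.one_apply, smul_eq_mul, mul_one, Fin.sum_univ_three] at hdeg
    rw [Finset.mem_image]
    refine ⟨⟨e 0, e 1⟩, ?_, ?_⟩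
    · simp only [hS, Finset.mem_sigma, Finset.mem_range]; omega
    · ext i
      fin_cases i
      · simp [hι]
      · simp [hι]
      · simp [hι]; omega
  conv_lhs => rw [f.as_sum]
  exact Finset.sum_subset hsub fun e _ he => by rw [notMem_support_iff.mp he, monomial_zero]

/-- A ternary monomial as a product of powers of the variables. [cite: BurgisserIkenmeyer2017, §7 (Appendix) Prop. 7.5] -/
theorem monomial_fin_three_eq (a b c : ℕ) (r : ℂ) :
    (monomial (Finsupp.single 0 a + Finsupp.single 1 b + Finsupp.single 2 c) r :
      MvPolynomial (Fin 3) ℂ) = C r * X 0 ^ a * X 1 ^ b * X 2 ^ c := by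
  rw [X_pow_eq_monomial, X_pow_eq_monomial, X_pow_eq_monomial, C_mul_monomial, monomial_mul,
    monomial_mul, mul_one, mul_one, mul_one]

/-- Evaluation of a ternary monomial at a point. [cite: BurgisserIkenmeyer2017, §7 (Appendix) Prop. 7.5] -/
theorem eval_monomial_fin_three (p₀ p₁ p₂ : ℂ) (a b c : ℕ) (r : ℂ) :
    eval ![p₀, p₁, p₂] (monomial (Finsupp.single 0 a + Finsupp.single 1 b + Finsupp.single 2 c) r) =
      r * (p₀ ^ a * p₁ ^ b * p₂ ^ c) := by
  rw [monomial_fin_three_eq]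
  simp [mul_assoc]

/-- Evaluating a linear substitution: `(M · f)(x) = f(Mᵀ x)`. [cite: BurgisserIkenmeyer2017, §7 (Appendix) Prop. 7.5] -/
theorem eval_linSubst_fin_three (M : Matrix (Fin 3) (Fin 3) ℂ) (x : Fin 3 → ℂ)
    (f : MvPolynomial (Fin 3) ℂ) :
    eval x (linSubst (Fin 3) ℂ M f) = eval (Matrix.mulVec M.transpose x) f := by
  induction f using MvPolynomial.induction_on with
  | C a => rw [linSubst_C, eval_C, eval_C]
  | add p q hp hq => rw [map_add, map_add, map_add, hp, hq]
  | mul_X p i hp =>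
    rw [map_mul, map_mul, map_mul, hp, linSubst_X, eval_X]
    congr 1
    simp [Matrix.mulVec, dotProduct, smul_eval]

/-- The regular unipotent substitution evaluated: `(u · f)(p₀, p₁, p₂) = f(p₀, p₀ + p₁, p₁ + p₂)`.
[cite: BurgisserIkenmeyer2017, §7 (Appendix) Prop. 7.5] -/
theorem eval_linSubst_unipotent (f : MvPolynomial (Fin 3) ℂ) (p₀ p₁ p₂ : ℂ) :
    eval ![p₀, p₁, p₂] (linSubst (Fin 3) ℂ !![1, 1, 0; 0, 1, 1; 0, 0, 1] f) =
      eval ![p₀, p₀ + p₁, p₁ + p₂] f := by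
  rw [eval_linSubst_fin_three]
  have hv : (!![1, 1, 0; 0, 1, 1; 0, 0, 1] : Matrix (Fin 3) (Fin 3) ℂ).transpose.mulVec ![p₀, p₁, p₂] =
      ![p₀, p₀ + p₁, p₁ + p₂] := by
    ext i
    fin_cases i <;> simp [Matrix.mulVec, dotProduct, Fin.sum_univ_three]
  rw [hv]

end Expansion

/-! ### §2 Quartics fixed by the regular unipotent substitution -/

section Fixed

/-- **Quartics fixed by the regular unipotent substitution.** If `u · f = f` for a ternary
quartic form `f`, where `u` is `x₀ ↦ x₀`, `x₁ ↦ x₀ + x₁`, `x₂ ↦ x₁ + x₂`, then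
`f = c₁ x₀⁴ + c₂ x₀² q + c₃ q²` with `q = x₁² - 2 x₀ x₂ - x₀ x₁` (so the fixed space is the
`3`-dimensional span of `x₀⁴, x₀² q, q²`; `c₁, c₂, c₃` are the coefficients of `x₀⁴`, minus that
of `x₀³ x₁`, and that of `x₁⁴`). The regular-unipotent case of the dimension count for generic
ternary quartics (BI 2017 Thm. 2.3 at `(4,3)` as corrected; Poonen 2005 Thm. 3 at `(1,4)`); the
linear algebra is certified by twelve point evaluations and a rational certificate.
[cite: BurgisserIkenmeyer2017, §7 (Appendix) Prop. 7.5] -/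
theorem exists_eq_of_unipotent_fixed_quartic {f : MvPolynomial (Fin 3) ℂ} (hf : f.IsHomogeneous 4)
    (hfix : linSubst (Fin 3) ℂ !![1, 1, 0; 0, 1, 1; 0, 0, 1] f = f) :
    ∃ c₁ c₂ c₃ : ℂ, f = C c₁ * X 0 ^ 4 + C c₂ * (X 0 ^ 2 * (X 1 ^ 2 - 2 * X 0 * X 2 - X 0 * X 1)) +
      C c₃ * (X 1 ^ 2 - 2 * X 0 * X 2 - X 0 * X 1) ^ 2 := by
  have hev : ∀ p₀ p₁ p₂ : ℂ, eval ![p₀, p₀ + p₁, p₁ + p₂] f = eval ![p₀, p₁, p₂] f :=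
    fun p₀ p₁ p₂ => by rw [← eval_linSubst_unipotent, hfix]
  have hexp := eq_sum_monomial_fin_three hf
  simp only [Finset.sum_range_succ, Finset.sum_range_zero, zero_add, Nat.reduceSub,
    tsub_zero] at hexp
  -- twelve point evaluations
  have hpt : ∀ p₀ p₁ p₂ : ℂ,
      eval ![p₀, p₀ + p₁, p₁ + p₂] (∑ a ∈ Finset.range 5, ∑ b ∈ Finset.range (5 - a),
        monomial (Finsupp.single 0 a + Finsupp.single 1 b + Finsupp.single 2 (4 - a - b))
          (coeff (Finsupp.single 0 a + Finsupp.single 1 b + Finsupp.single 2 (4 - a - b)) f)) =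
      eval ![p₀, p₁, p₂] (∑ a ∈ Finset.range 5, ∑ b ∈ Finset.range (5 - a),
        monomial (Finsupp.single 0 a + Finsupp.single 1 b + Finsupp.single 2 (4 - a - b))
          (coeff (Finsupp.single 0 a + Finsupp.single 1 b + Finsupp.single 2 (4 - a - b)) f)) := by
    intro p₀ p₁ p₂
    have h := hev p₀ p₁ p₂
    rw [eq_sum_monomial_fin_three hf] at h
    exact h
  simp only [Finset.sum_range_succ, Finset.sum_range_zero, zero_add, Nat.reduceSub, tsub_zero,
    map_add, eval_monomial_fin_three] at hpt
  -- opaque names for the fifteen coefficients `k_{abc} = coeff (x₀^a x₁^b x₂^c) f`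
  generalize coeff (Finsupp.single (0 : Fin 3) 0 + Finsupp.single 1 0 + Finsupp.single 2 4) f = k004 at hexp hpt
  generalize coeff (Finsupp.single (0 : Fin 3) 0 + Finsupp.single 1 1 + Finsupp.single 2 3) f = k013 at hexp hpt
  generalize coeff (Finsupp.single (0 : Fin 3) 0 + Finsupp.single 1 2 + Finsupp.single 2 2) f = k022 at hexp hpt
  generalize coeff (Finsupp.single (0 : Fin 3) 0 + Finsupp.single 1 3 + Finsupp.single 2 1) f = k031 at hexp hpt
  generalize coeff (Finsupp.single (0 : Fin 3) 0 + Finsupp.single 1 4 + Finsupp.single 2 0) f = k040 at hexp hpt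
  generalize coeff (Finsupp.single (0 : Fin 3) 1 + Finsupp.single 1 0 + Finsupp.single 2 3) f = k103 at hexp hpt
  generalize coeff (Finsupp.single (0 : Fin 3) 1 + Finsupp.single 1 1 + Finsupp.single 2 2) f = k112 at hexp hpt
  generalize coeff (Finsupp.single (0 : Fin 3) 1 + Finsupp.single 1 2 + Finsupp.single 2 1) f = k121 at hexp hpt
  generalize coeff (Finsupp.single (0 : Fin 3) 1 + Finsupp.single 1 3 + Finsupp.single 2 0) f = k130 at hexp hpt
  generalize coeff (Finsupp.single (0 : Fin 3) 2 + Finsupp.single 1 0 + Finsupp.single 2 2) f = k202 at hexp hpt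
  generalize coeff (Finsupp.single (0 : Fin 3) 2 + Finsupp.single 1 1 + Finsupp.single 2 1) f = k211 at hexp hpt
  generalize coeff (Finsupp.single (0 : Fin 3) 2 + Finsupp.single 1 2 + Finsupp.single 2 0) f = k220 at hexp hpt
  generalize coeff (Finsupp.single (0 : Fin 3) 3 + Finsupp.single 1 0 + Finsupp.single 2 1) f = k301 at hexp hpt
  generalize coeff (Finsupp.single (0 : Fin 3) 3 + Finsupp.single 1 1 + Finsupp.single 2 0) f = k310 at hexp hpt
  generalize coeff (Finsupp.single (0 : Fin 3) 4 + Finsupp.single 1 0 + Finsupp.single 2 0) f = k400 at hexp hpt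
  have e0 := hpt (-1) 0 0
  have e1 := hpt 0 (-1) 0
  have e2 := hpt (-1) (-1) 0
  have e3 := hpt (-1) 0 (-1)
  have e4 := hpt (-1) 0 1
  have e5 := hpt (-1) 1 0
  have e6 := hpt 0 (-1) (-1)
  have e7 := hpt 0 (-1) 1
  have e8 := hpt (-1) (-1) (-1)
  have e9 := hpt (-1) (-1) 1
  have e10 := hpt (-1) 1 (-1)
  have e11 := hpt (-2) (-1) 0
  ring_nf at e0 e1 e2 e3 e4 e5 e6 e7 e8 e9 e10 e11
  -- (the twelve relations, each a rational combination of the point equations)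
  have r004 : k004 = 0 := by
    linear_combination (1/3 : ℂ) * e0 + (-5/12 : ℂ) * e1 + (1/12 : ℂ) * e2 + (-1/4 : ℂ) * e3 + (-1/12 : ℂ) * e4 + (-1/12 : ℂ) * e5 + (1/12 : ℂ) * e6 + (-1/6 : ℂ) * e7 + (-1/12 : ℂ) * e9 + (1/12 : ℂ) * e10
  have r013 : k013 = 0 := by
    linear_combination (-2/3 : ℂ) * e0 + (1/2 : ℂ) * e1 + (-1/6 : ℂ) * e2 + (1/2 : ℂ) * e3 + (1/6 : ℂ) * e4 + (1/6 : ℂ) * e5 + (1/2 : ℂ) * e7 + (1/6 : ℂ) * e9 + (-1/6 : ℂ) * e10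
  have r022 : k022 = 0 := by
    linear_combination (-1/3 : ℂ) * e0 + (11/12 : ℂ) * e1 + (-1/12 : ℂ) * e2 + (1/4 : ℂ) * e3 + (1/12 : ℂ) * e4 + (1/12 : ℂ) * e5 + (-1/12 : ℂ) * e6 + (-1/3 : ℂ) * e7 + (1/12 : ℂ) * e9 + (-1/12 : ℂ) * e10
  have r031 : k031 = 0 := by
    linear_combination (2/3 : ℂ) * e0 + (1/6 : ℂ) * e2 + (-1/2 : ℂ) * e3 + (-1/6 : ℂ) * e4 + (-1/6 : ℂ) * e5 + (-1/6 : ℂ) * e9 + (1/6 : ℂ) * e10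
  have r103 : k103 = 0 := by
    linear_combination (11/9 : ℂ) * e0 + (-7/9 : ℂ) * e1 + (-1/9 : ℂ) * e2 + (-5/6 : ℂ) * e3 + (-7/18 : ℂ) * e4 + (-2/9 : ℂ) * e5 + (-1/9 : ℂ) * e6 + (-4/9 : ℂ) * e7 + (1/6 : ℂ) * e8 + (-1/18 : ℂ) * e9 + (2/9 : ℂ) * e10
  have r112 : k112 = 0 := by
    linear_combination (-2/3 : ℂ) * e0 + (-11/12 : ℂ) * e1 + (1/12 : ℂ) * e2 + (1/4 : ℂ) * e3 + (5/12 : ℂ) * e4 + (-1/12 : ℂ) * e5 + (1/12 : ℂ) * e6 + (1/3 : ℂ) * e7 + (-1/12 : ℂ) * e9 + (1/12 : ℂ) * e10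
  have r121 : k121 = -4 * k040 := by
    linear_combination (7/9 : ℂ) * e0 + (-41/36 : ℂ) * e1 + (31/36 : ℂ) * e2 + (13/12 : ℂ) * e3 + (5/36 : ℂ) * e4 + (5/36 : ℂ) * e5 + (7/36 : ℂ) * e6 + (5/18 : ℂ) * e7 + (-1/6 : ℂ) * e8 + (11/36 : ℂ) * e9 + (-17/36 : ℂ) * e10 + (-1/6 : ℂ) * e11
  have r130 : k130 = -2 * k040 := by
    linear_combination (-1/2 : ℂ) * e0 + (1/6 : ℂ) * e4 + (1/6 : ℂ) * e5 + (1/6 : ℂ) * e9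
  have r202 : k202 = 4 * k040 := by
    linear_combination (-23/18 : ℂ) * e0 + (23/36 : ℂ) * e1 + (-31/36 : ℂ) * e2 + (-7/12 : ℂ) * e3 + (-5/36 : ℂ) * e4 + (13/36 : ℂ) * e5 + (-7/36 : ℂ) * e6 + (2/9 : ℂ) * e7 + (1/6 : ℂ) * e8 + (-11/36 : ℂ) * e9 + (-1/36 : ℂ) * e10 + (1/6 : ℂ) * e11
  have r211 : k211 = 4 * k040 := by
    linear_combination (-7/9 : ℂ) * e0 + (23/36 : ℂ) * e1 + (-31/36 : ℂ) * e2 + (-7/12 : ℂ) * e3 + (-23/36 : ℂ) * e4 + (-5/36 : ℂ) * e5 + (-7/36 : ℂ) * e6 + (-7/9 : ℂ) * e7 + (1/6 : ℂ) * e8 + (-11/36 : ℂ) * e9 + (17/36 : ℂ) * e10 + (1/6 : ℂ) * e11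
  have r220 : k220 = -k310 + k040 := by
    linear_combination (3/2 : ℂ) * e0 + (-1/6 : ℂ) * e4 + (-1/6 : ℂ) * e5 + (-1/6 : ℂ) * e9
  have r301 : k301 = 2 * k310 := by
    linear_combination (-25/6 : ℂ) * e0 + (1 : ℂ) * e1 + (-2/3 : ℂ) * e2 + (1/2 : ℂ) * e4 + (-1/6 : ℂ) * e5 + (1/2 : ℂ) * e7 + (-1/6 : ℂ) * e10 + (1/6 : ℂ) * e11
  refine ⟨k400, -k310, k040, ?_⟩
  rw [hexp, r004, r013, r022, r031, r103, r112, r121, r130, r202, r211, r220, r301]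
  simp only [monomial_fin_three_eq, map_zero, map_neg, map_add, map_mul, map_ofNat]
  ring

end Fixed

end Literature.Computability.AlgebraicComplexity
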